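import Summits.QuantumFields.YangMills.Theorems.UnitScaleTiltProp7CombBoxBlockDictionary
import Summits.QuantumFields.YangMills.Theorems.UnitScaleTiltProp7SectET3CombLettersT3
import Summits.QuantumFields.YangMills.Theorems.UnitScaleTiltProp7BernPFlatMember
import HarnessLib

/-!
# `UnitScaleTiltProp7CombGaugeKernelTranslate` — THE COMB AND THE S RESIDUAL GAUGE ALGEBRAS AT THE FLAT MEMBER ARE HALF-BLOCK TRANSLATES, IN THE HILBERT LETTERS:
# **`toL2S λ ∈ N_c(1) ↔ toL2S (λ ∘ t_{x₀}) ∈ N_S(1)`**, `t_{x₀} x = transl x (labels x₀)`, `x₀ = basePt F n K` (label `(L^{K−n}−1)∕2` per axis)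
(route `UnitScaleTilt`, crux K1 «MinimiserStabilityRegPr» stmt-QuantumFields-19200; ★★OWNER ym3-torus-plan g29 RULING №18 (2) «`N_c(1) = τ·N_S(1)`» — the kernel half of item (b1) of px6 g5's
LOCATE-COMBFLAT ADDENDUM (F*); def-free, count-neutral).
Cell `ym3-torus` (HUMAN RULING D-0037, YM ladder rung R3 — YM₃ on T³ is a rung, not d = 4, not a mass gap, not Clay), width seat `ym3-torus-px6` (gen 5).

WHAT IS PROVED (sorry-free, no definition; `D(1)(toL2S λ) = toL2 (b ↦ η⁻¹·(λ(b₊) − λ(b₋)))` is ✓`Prop7BernPFlatMember.DL2_one_toL2S`, reused): `gaugeDir_eq_neg_smul` —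
`(b ↦ η⁻¹·(λ(b₊) − λ(b₋))) = −(η⁻¹ • D♭λ)`, `D♭λ := b ↦ λ(b₋) − λ(b₊)`, so `Q_c(1)D(1)(toL2S λ) = toL2B(−η⁻¹·QTw 1 (D♭λ))` and `Q_S(1)D(1)(toL2S λ) = toL2B(−η⁻¹·QTwS 1 (D♭λ))` (✓`QL2c_toL2`, ✓`QL2_toL2`, linearity); ★★★
**`toL2S_mem_NSc_one_iff`** — `toL2S λ ∈ NSc … 1 ↔ toL2S (λ ∘ t_{x₀}) ∈ NS … 1` (✓`Prop7CombBoxBlockDictionary.QTw_one_gaugeDir_eq_QTwS_transl`: `QTw 1 (D♭λ) = QTwS 1 (D♭(λ ∘ t_{x₀}))`;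
`toL2B` injective, `η⁻¹ ≠ 0`).  REMAINING for row (hR) of ✓`Prop7LaplaceAcFlatTransfer.coercive_laplaceAc_one_of_sliceBound_conj` (item (b1), named): the translation `λ ↦ λ ∘ t_{x₀}` as a
unitary `τ_S` of `SiteL2K` (and `τ` of `BondL2K`) commuting with `covLapSite 1`, `DL2 1`, `DeltaEta 1`, and the transport `Rc 1 = τ_S ∘ RS 1 ∘ τ_S⁻¹` of ✓`Rc_eq_projR`∕✓`RS_eq_projR`.
HONEST FRAMING.  Nothing of COMB-FLAT COERCIVITY's content (I3′), of HESS ∕ E′ ∕ EX ∕ the crux K1 is proved; rung R3, not Clay; YM gap NOT proved.  `--supports stmt-QuantumFields-19200 --as helper`.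
References: T. Bałaban, CMP 99 (1985) 389–434 [Balaban1985BackgroundPropagators] ((3.3) p.391, (3.21) p.394, (3.115) p.418).
-/

noncomputable section

open scoped Matrix.Norms.L2Operator Topology

namespace Summit.QuantumFields.YangMills.Theorems.Prop7CombGaugeKernelTranslate

open Literature.MathematicalPhysics.QuantumFieldTheory.Balaban1983to89
open Literature.MathematicalPhysics.QuantumFieldTheory.Balaban1983to89.T3ContinuumYM3Torus
open T3SectALandauChart (eta eta_pos)
open B9Eq311L2Pairing (WL2)
open B11Eq103H1Complex (SiteL2K BondL2K)
open B10Eq27TorusAxialLog (transl)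
open Summit.QuantumFields.YangMills.Theorems.Prop7SPrint (basePt)
open Summit.QuantumFields.YangMills.Theorems.Prop7SectET3Transport (periodsT3 bondEquiv bgOfCfg)
open Summit.QuantumFields.YangMills.Theorems.Prop7SectET3HilbertLetters (W₂ toL2 toL2S toL2B QL2 DL2 QL2_toL2 DL2_apply)
open Summit.QuantumFields.YangMills.Theorems.Prop7SectET3GaugeProjector (QDS NS mem_NS_iff)
open Summit.QuantumFields.YangMills.Theorems.Prop7SectET3CombLetters (QL2c QDc NSc QL2c_toL2 mem_NSc_iff)
open Summit.QuantumFields.YangMills.Theorems.Prop7SymAvgTw (QTw)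
open Summit.QuantumFields.YangMills.Theorems.Prop7SymAvgTwSym (QTwS)
open Summit.QuantumFields.YangMills.Theorems.Prop7BernPFlatMember (DL2_one_toL2S)
open Summit.QuantumFields.YangMills.Theorems.Prop7CombBoxBlockDictionary (QTw_one_gaugeDir_eq_QTwS_transl)

variable (F : T3Family) {n K : ℕ} (h : n ≤ K) {c₀ : ℝ} [Fact (0 < c₀)]

/-- the flat gauge direction with the spacing factor: `b ↦ η⁻¹·(λ(b₊) − λ(b₋)) = −(η⁻¹ • D♭λ)`, `D♭λ := b ↦ λ(b₋) − λ(b₊)`. [cite: Balaban1985BackgroundPropagators, (3.3) p.391] -/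
theorem gaugeDir_eq_neg_smul (lam : Site (F.P K) 0 → Matrix (Fin 2) (Fin 2) ℂ) :
    (fun b : PBond (F.P K) 0 => (((eta F n K : ℝ) : ℂ)⁻¹) • (lam b.tgt - lam b.src))
      = -((((eta F n K : ℝ) : ℂ)⁻¹) • fun b : PBond (F.P K) 0 => lam b.src - lam b.tgt) := by
  funext b
  simp only [Pi.neg_apply, Pi.smul_apply, ← smul_neg, neg_sub]

/-- ★★★ **`toL2S λ ∈ N_c(1) ↔ toL2S (λ ∘ t_{x₀}) ∈ N_S(1)`** — the comb and the S residual gauge algebras at the flat member are HALF-BLOCK TRANSLATES of each other (★★OWNER RULING №18 (2)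
«`N_c(1) = τ·N_S(1)`», kernel form): by ✓`QTw_one_gaugeDir_eq_QTwS_transl` (`QTw 1 (D♭λ) = QTwS 1 (D♭(λ ∘ t_{x₀}))`), ✓`QL2c_toL2`∕✓`QL2_toL2`, `DL2_one_toL2S`, injectivity of `toL2B` and `η⁻¹ ≠ 0`.
[cite: Balaban1985BackgroundPropagators, (3.21) p.394, (3.115) p.418] -/
theorem toL2S_mem_NSc_one_iff {cB : ℝ} (lam : Site (F.P K) 0 → Matrix (Fin 2) (Fin 2) ℂ) :
    toL2S F K c₀ lam ∈ NSc F n K h c₀ cB (1 : GaugeField (F.P K) 0 (Matrix.specialUnitaryGroup (Fin 2) ℂ))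
      ↔ toL2S F K c₀ (fun x : Site (F.P K) 0 => lam (transl x (fun μ => (((basePt F n K μ).val : ℕ) : ℤ))))
          ∈ NS F n K h c₀ cB (1 : GaugeField (F.P K) 0 (Matrix.specialUnitaryGroup (Fin 2) ℂ)) := by
  have hη : (((eta F n K : ℝ) : ℂ)⁻¹) ≠ 0 := inv_ne_zero (by exact_mod_cast (eta_pos F n K).ne')
  set cv : B7Prop1Explicit.Site (F.P K).d := fun μ => (((basePt F n K μ).val : ℕ) : ℤ) with hcv
  have e1 := gaugeDir_eq_neg_smul F (n := n) lam
  have e2 : (fun b : PBond (F.P K) 0 => (((eta F n K : ℝ) : ℂ)⁻¹) • (lam (transl b.tgt cv) - lam (transl b.src cv)))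
      = -((((eta F n K : ℝ) : ℂ)⁻¹) • fun b : PBond (F.P K) 0 => lam (transl b.src cv) - lam (transl b.tgt cv)) :=
    gaugeDir_eq_neg_smul F (n := n) (fun x : Site (F.P K) 0 => lam (transl x cv))
  have e3 := QTw_one_gaugeDir_eq_QTwS_transl F h lam
  rw [← hcv] at e3
  rw [mem_NSc_iff, mem_NS_iff, DL2_one_toL2S (F := F) (n := n), DL2_one_toL2S (F := F) (n := n), QL2c_toL2, QL2_toL2, LinearEquiv.map_eq_zero_iff, LinearEquiv.map_eq_zero_iff,
    e1, map_neg, map_smul, neg_eq_zero, smul_eq_zero, e3]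
  -- the S side
  have hS : (fun b : PBond (F.P K) 0 => (((eta F n K : ℝ) : ℂ)⁻¹) • ((fun x : Site (F.P K) 0 => lam (transl x cv)) b.tgt - (fun x : Site (F.P K) 0 => lam (transl x cv)) b.src))
      = -((((eta F n K : ℝ) : ℂ)⁻¹) • fun b : PBond (F.P K) 0 => lam (transl b.src cv) - lam (transl b.tgt cv)) := e2
  rw [hS, map_neg, map_smul, neg_eq_zero, smul_eq_zero]

end Summit.QuantumFields.YangMills.Theorems.Prop7CombGaugeKernelTranslate

end
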